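import Literature.MathematicalPhysics.KineticTheory.InfiniteChainStaticCurrentVariance
import Literature.MathematicalPhysics.KineticTheory.InfiniteChainCurrentMoments
import Literature.MathematicalPhysics.KineticTheory.LangevinChainLaSalle
import HarnessLib

/-!
# `stub_currentVariancePos` of line `temperature-blind-vitali-hurwitz`
(crux `EmbeddedDrudeMourre.GreenKuboContinuation`, item stmt-AtomisticToContinuum-12597;
`--supports` helper file closing the registered stub of the skeleton
`Cruxes/GreenKuboContinuation/Lines/temperature_blind_vitali_hurwitz.lean`)

**The static current variance of a regular state of the pinned anharmonic chain is positive.**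
For `P = pinnedChain ω₂ lam β γ` (`U(q) = ω₂q²/2 + lam q⁴/4`, `V(r) = r²/2 + βr⁴/4`, all four
parameters `> 0`), any infinite-volume dynamics `D` (the line freezes the Buttà–Marchioro flow on
`bmGood`, but only `D.PreservesMeasure μ` is used), every `T > 0` and every DLR Gibbs state `μ` at
`T` that is shift-invariant, obeys BM's superstability estimate (2.3) and is preserved by `D`:
`0 < C_T(0) = D.currentCorrelation μ 0 = ∑_x ∫ j_0 (j_x ∘ φ_0) dμ`.

Proof (`currentCorrelation_zero_pos`, stated for any chain with `U ≥ 0` continuous, `V` an even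
polynomial of degree `≥ 2` and `V'` "odd-injective"): by the Literature theorem
`InfiniteChainDynamics.currentCorrelation_zero_eq_variance`
(`Literature/MathematicalPhysics/KineticTheory/InfiniteChainStaticCurrentVariance.lean`, landed
with this stub together with `InfiniteChainGibbsMomentaIndependence.lean`: under a DLR state each
momentum is `N(0,T)` and independent of the position field, LLL 1977 §4 remark (ii)),
`C(0) = (T/4) ∫ (V'(q_1 - q_0) + V'(q_2 - q_1))² dμ`, the finitely many moments involved being
integrable under (2.3) (`exists_moment_bounds_of_hasSuperstabilityEstimate`: `|p_i| ≤ W`,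
`|V'(r)| ≤ 2C₁C₂ W` on the box `{-2,…,2}`, all powers of `W = W_{0,2}` integrable,
`InfiniteChainCurrentMoments`). The integrand is `≥ 0` and vanishes only where
`V'(r_0) + V'(r_1) = 0`, i.e. (for `V'(r) = r + βr³`, odd and strictly increasing) where
`q_0 = q_2` — a `μ`-null event for every DLR state (`IsChainGibbsMeasure.measure_fst_eq_fst`: the
one-site kernel at site `0` is absolutely continuous w.r.t. `dq_0 dp_0`). Hence the integral, and
`C(0)`, are strictly positive. The hypotheses `0 < γ`, `0 < lam` (only `lam ≥ 0` is used) and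
`D.carrier = bmGood` are not needed.
-/

noncomputable section

namespace Summit.AtomisticToContinuum.FouriersLaw.Theorems.GreenKuboContinuation.TemperatureBlindVitaliHurwitz

open Filter Topology MeasureTheory Set
open scoped ENNReal
open Literature.MathematicalPhysics.KineticTheory.HeatConduction

/-- **Moment integrability under the superstability estimate.** For a chain with `U ≥ 0`
measurable and `V` an even non-negative polynomial of degree `2s₂ ≥ 2`, and a state `μ` with
Buttà–Marchioro's estimate (2.3): with `W = W_{0,2}` the local energy of the box `{-2, …, 2}` there
is `c ≥ 0` with `|V'(q_1 - q_0)|, |V'(q_2 - q_1)| ≤ c W`, and every measurable observable `e` with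
`|e| ≤ K W²` is integrable together with its momentum-weighted versions `p_i p_j e`,
`i, j ∈ {-2, …, 2}` (`|p_i| ≤ W`, `|V'(r)| ≤ C₁(1+|r|)^{2s₂-1} ≤ 2C₁C₂ W` on a bond of the box, and
all powers of `W` are integrable, `exists_integral_bmLocalEnergy_pow_le`). [folklore] -/
theorem exists_moment_bounds_of_hasSuperstabilityEstimate {P : OscillatorChain} {s₂ : ℕ}
    (h₂ : 1 ≤ s₂) (hU0 : ∀ r, 0 ≤ P.U r) (hUm : Measurable P.U)
    (hVp : OscillatorChain.IsEvenPolyOfDegree P.V s₂) {μ : Measure ChainConfig}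
    (hss : P.HasSuperstabilityEstimate μ) :
    ∃ c : ℝ, 0 ≤ c ∧
      (∀ σ : ChainConfig, |deriv P.V ((σ 1).1 - (σ 0).1)| ≤ c * P.bmLocalEnergy 0 2 σ) ∧
      (∀ σ : ChainConfig, |deriv P.V ((σ 2).1 - (σ 1).1)| ≤ c * P.bmLocalEnergy 0 2 σ) ∧
      (∀ (K : ℝ) (e : ChainConfig → ℝ), Measurable e →
        (∀ σ, |e σ| ≤ K * P.bmLocalEnergy 0 2 σ ^ 2) →
        Integrable e μ ∧ ∀ i j : ℤ, -2 ≤ i → i ≤ 2 → -2 ≤ j → j ≤ 2 →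
          Integrable (fun σ : ChainConfig => (σ i).2 * (σ j).2 * e σ) μ) := by
  have hV0 : ∀ r, 0 ≤ P.V r := hVp.choose_spec.2.2
  have hVm : Measurable P.V := hVp.continuous.measurable
  obtain ⟨C₁, hC₁, hV', -⟩ := hVp.exists_deriv_bound
  obtain ⟨C₂, hC₂, hcoer⟩ := hVp.exists_one_add_abs_pow_le h₂
  obtain ⟨C, lam₀, -, -, hW⟩ := hss.exists_integral_bmLocalEnergy_pow_le hU0 hV0 hUm hVm
  set W : ChainConfig → ℝ := fun σ => P.bmLocalEnergy 0 2 σ with hWdef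
  have hW1 : ∀ σ, 1 ≤ W σ := fun σ => OscillatorChain.one_le_bmLocalEnergy hU0 hV0 0 2 σ
  have hmem : ∀ i : ℤ, -2 ≤ i → i ≤ 2 →
      i ∈ Finset.Icc ((0 : ℤ) - ((2 : ℕ) : ℤ)) (0 + ((2 : ℕ) : ℤ)) :=
    fun i h1 h2 => by simp only [Finset.mem_Icc]; omega
  have hp : ∀ (σ : ChainConfig) (i : ℤ), -2 ≤ i → i ≤ 2 → |(σ i).2| ≤ W σ := fun σ i h1 h2 =>
    OscillatorChain.abs_snd_le_bmLocalEnergy hU0 hV0 σ (hmem i h1 h2)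
  -- derivative bound on a bond of the box (as in `exists_abs_bondCurrentZ_le`)
  have hdV : ∀ (σ : ChainConfig) (r : ℝ), P.V r ≤ W σ → |deriv P.V r| ≤ 2 * C₁ * C₂ * W σ := by
    intro σ r hVr
    have h1 : (1 + |r|) ^ (2 * s₂ - 1) ≤ (1 + |r|) ^ (2 * s₂) :=
      pow_le_pow_right₀ (by linarith [abs_nonneg r]) (Nat.sub_le _ _)
    calc |deriv P.V r| ≤ C₁ * (1 + |r|) ^ (2 * s₂ - 1) := hV' r
      _ ≤ C₁ * (1 + |r|) ^ (2 * s₂) := mul_le_mul_of_nonneg_left h1 hC₁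
      _ ≤ C₁ * (C₂ * (P.V r + 1)) := mul_le_mul_of_nonneg_left (hcoer r) hC₁
      _ ≤ C₁ * (C₂ * (2 * W σ)) := by gcongr; linarith [hW1 σ]
      _ = 2 * C₁ * C₂ * W σ := by ring
  have hbond : ∀ (σ : ChainConfig) (i : ℤ), -1 ≤ i → i ≤ 2 →
      P.V ((σ i).1 - (σ (i - 1)).1) ≤ W σ := fun σ i h1 h2 =>
    OscillatorChain.bond_le_bmLocalEnergy hU0 hV0 σ (hmem i (by omega) h2)
      (hmem (i - 1) (by omega) (by omega))
  have ha : ∀ σ : ChainConfig, |deriv P.V ((σ 1).1 - (σ 0).1)| ≤ 2 * C₁ * C₂ * W σ := fun σ =>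
    hdV σ _ (by have h := hbond σ 1 (by norm_num) (by norm_num); norm_num at h; exact h)
  have hb : ∀ σ : ChainConfig, |deriv P.V ((σ 2).1 - (σ 1).1)| ≤ 2 * C₁ * C₂ * W σ := fun σ =>
    hdV σ _ (by have h := hbond σ 2 (by norm_num) (by norm_num); norm_num at h; exact h)
  refine ⟨2 * C₁ * C₂, by positivity, ha, hb, ?_⟩
  intro K e he hbd
  have hdom : ∀ n : ℕ, Integrable (fun σ => |K| * W σ ^ n) μ := fun n => (hW 0 2 n).1.const_mul _
  refine ⟨?_, fun i j hi1 hi2 hj1 hj2 => ?_⟩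
  · refine (hdom 2).mono' he.aestronglyMeasurable (Eventually.of_forall fun σ => ?_)
    rw [Real.norm_eq_abs]
    exact (hbd σ).trans (mul_le_mul_of_nonneg_right (le_abs_self K) (by positivity))
  · have hm : Measurable fun σ : ChainConfig => (σ i).2 * (σ j).2 * e σ :=
      (((measurable_pi_apply i).snd).mul ((measurable_pi_apply j).snd)).mul he
    refine (hdom 4).mono' hm.aestronglyMeasurable (Eventually.of_forall fun σ => ?_)
    rw [Real.norm_eq_abs, abs_mul, abs_mul]
    have hW0 : 0 ≤ W σ := zero_le_one.trans (hW1 σ)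
    calc |(σ i).2| * |(σ j).2| * |e σ| ≤ W σ * W σ * (|K| * W σ ^ 2) := by
          refine mul_le_mul (mul_le_mul (hp σ i hi1 hi2) (hp σ j hj1 hj2) (abs_nonneg _) hW0)
            ((hbd σ).trans (mul_le_mul_of_nonneg_right (le_abs_self K) (by positivity)))
            (abs_nonneg _) (mul_nonneg hW0 hW0)
      _ = |K| * W σ ^ 4 := by ring

/-- **Positivity of the static current variance.** For a chain with `U ≥ 0` continuous, `V` an even
non-negative polynomial of degree `2s₂ ≥ 2` whose derivative is "odd-injective"
(`V'(r) + V'(r') = 0 ⟹ r + r' = 0`, e.g. `V'` odd and injective), a dynamics `D` preserving a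
shift-invariant DLR state `μ` at `T > 0` obeying the superstability estimate (2.3):
`0 < C(0) = D.currentCorrelation μ 0`. Indeed `C(0) = (T/4) ∫ (V'(r_0) + V'(r_1))² dμ`
(`currentCorrelation_zero_eq_variance`, the moments being integrable by
`exists_moment_bounds_of_hasSuperstabilityEstimate`), the integrand is non-negative and vanishes
only if `r_0 + r_1 = q_2 - q_0 = 0`, a `μ`-null event (`measure_fst_eq_fst`). [folklore] -/
theorem currentCorrelation_zero_pos {P : OscillatorChain} {s₂ : ℕ} (h₂ : 1 ≤ s₂)
    (hU0 : ∀ r, 0 ≤ P.U r) (hU : Continuous P.U) (hVp : OscillatorChain.IsEvenPolyOfDegree P.V s₂)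
    (hVinj : ∀ r r' : ℝ, deriv P.V r + deriv P.V r' = 0 → r + r' = 0)
    (D : InfiniteChainDynamics P) {T : ℝ} (hT : 0 < T) {μ : Measure ChainConfig}
    (hμ : P.IsChainGibbsMeasure T μ) (hshift : IsShiftInvariant μ)
    (hss : P.HasSuperstabilityEstimate μ) (hD : D.PreservesMeasure μ) :
    0 < D.currentCorrelation μ 0 := by
  haveI : IsProbabilityMeasure μ := hμ.1
  have hV : Continuous P.V := hVp.continuous
  have hV0 : ∀ r, 0 ≤ P.V r := hVp.choose_spec.2.2
  obtain ⟨c, hc, ha, hb, hI⟩ :=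
    exists_moment_bounds_of_hasSuperstabilityEstimate h₂ hU0 hU.measurable hVp hss
  have hq : ∀ x : ℤ, Measurable fun σ : ChainConfig => (σ x).1 := fun x =>
    (measurable_pi_apply x).fst
  have ham : Measurable fun σ : ChainConfig => deriv P.V ((σ 1).1 - (σ 0).1) :=
    (measurable_deriv P.V).comp ((hq 1).sub (hq 0))
  have hbm : Measurable fun σ : ChainConfig => deriv P.V ((σ 2).1 - (σ 1).1) :=
    (measurable_deriv P.V).comp ((hq 2).sub (hq 1))
  have hW0 : ∀ σ : ChainConfig, 0 ≤ P.bmLocalEnergy 0 2 σ := fun σ =>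
    zero_le_one.trans (OscillatorChain.one_le_bmLocalEnergy hU0 hV0 0 2 σ)
  -- the three position observables and their bounds by `W²`
  have e_a2 : ∀ σ : ChainConfig, |deriv P.V ((σ 1).1 - (σ 0).1) ^ 2| ≤
      c ^ 2 * P.bmLocalEnergy 0 2 σ ^ 2 := fun σ => by
    rw [abs_pow, ← mul_pow]
    exact pow_le_pow_left₀ (abs_nonneg _) (ha σ) 2
  have e_ab : ∀ σ : ChainConfig,
      |deriv P.V ((σ 1).1 - (σ 0).1) * deriv P.V ((σ 2).1 - (σ 1).1)| ≤
      c ^ 2 * P.bmLocalEnergy 0 2 σ ^ 2 := fun σ => by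
    rw [abs_mul]
    calc |deriv P.V ((σ 1).1 - (σ 0).1)| * |deriv P.V ((σ 2).1 - (σ 1).1)|
        ≤ (c * P.bmLocalEnergy 0 2 σ) * (c * P.bmLocalEnergy 0 2 σ) :=
          mul_le_mul (ha σ) (hb σ) (abs_nonneg _) (mul_nonneg hc (hW0 σ))
      _ = c ^ 2 * P.bmLocalEnergy 0 2 σ ^ 2 := by ring
  have e_s2 : ∀ σ : ChainConfig,
      |(deriv P.V ((σ 1).1 - (σ 0).1) + deriv P.V ((σ 2).1 - (σ 1).1)) ^ 2| ≤
      (2 * c) ^ 2 * P.bmLocalEnergy 0 2 σ ^ 2 := fun σ => by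
    rw [abs_pow, ← mul_pow]
    refine pow_le_pow_left₀ (abs_nonneg _) ((abs_add_le _ _).trans ?_) 2
    linarith [ha σ, hb σ]
  obtain ⟨ha2, hIa2⟩ := hI (c ^ 2) (fun σ => deriv P.V ((σ 1).1 - (σ 0).1) ^ 2)
    (ham.pow_const 2) e_a2
  obtain ⟨hab, hIab⟩ := hI (c ^ 2)
    (fun σ => deriv P.V ((σ 1).1 - (σ 0).1) * deriv P.V ((σ 2).1 - (σ 1).1)) (ham.mul hbm) e_ab
  obtain ⟨hs2, -⟩ := hI ((2 * c) ^ 2)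
    (fun σ => (deriv P.V ((σ 1).1 - (σ 0).1) + deriv P.V ((σ 2).1 - (σ 1).1)) ^ 2)
    ((ham.add hbm).pow_const 2) e_s2
  rw [D.currentCorrelation_zero_eq_variance hU hV hT hμ hshift hD
    (fun i j h1 h2 h3 h4 => hIa2 i j (by omega) (by omega) (by omega) (by omega))
    (fun i j h1 h2 h3 h4 => hIab i j (by omega) h2 (by omega) h4) ha2 hab]
  refine mul_pos (by positivity) ?_
  rw [integral_pos_iff_support_of_nonneg_ae (Eventually.of_forall fun σ => sq_nonneg _) hs2]
  have hS : MeasurableSet {σ : ChainConfig | (σ 0).1 = (σ 2).1} :=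
    measurableSet_eq_fun (hq 0) (hq 2)
  have hone : μ {σ : ChainConfig | (σ 0).1 = (σ 2).1}ᶜ = 1 :=
    (prob_compl_eq_one_iff hS).2 (hμ.measure_fst_eq_fst (by norm_num))
  have hsub : {σ : ChainConfig | (σ 0).1 = (σ 2).1}ᶜ ⊆ Function.support fun σ : ChainConfig =>
      (deriv P.V ((σ 1).1 - (σ 0).1) + deriv P.V ((σ 2).1 - (σ 1).1)) ^ 2 := by
    intro σ hσ h0
    have h := hVinj _ _ ((pow_eq_zero_iff two_ne_zero).1 h0)
    exact hσ (by show (σ 0).1 = (σ 2).1; linarith)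
  calc (0 : ℝ≥0∞) < 1 := one_pos
    _ = μ {σ : ChainConfig | (σ 0).1 = (σ 2).1}ᶜ := hone.symm
    _ ≤ μ (Function.support fun σ : ChainConfig =>
        (deriv P.V ((σ 1).1 - (σ 0).1) + deriv P.V ((σ 2).1 - (σ 1).1)) ^ 2) := measure_mono hsub

/-- For the FPU-β coupling with `β ≥ 0`, `V'(r) + V'(r') = 0` forces `r + r' = 0`: `V'(r) = r + βr³`
(`pinnedChain_deriv_V`, `LangevinChainNESSProofs`) is odd and injective
(`pinnedChain_deriv_V_injective`, `LangevinChainLaSalle`). [folklore] -/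
theorem pinnedChain_deriv_V_add_eq_zero {ω₂ lam β : ℝ} (γ : ℝ) (hβ : 0 ≤ β) (r r' : ℝ)
    (h : deriv (pinnedChain ω₂ lam β γ).V r + deriv (pinnedChain ω₂ lam β γ).V r' = 0) :
    r + r' = 0 := by
  have hodd : deriv (pinnedChain ω₂ lam β γ).V (-r') = -deriv (pinnedChain ω₂ lam β γ).V r' := by
    rw [pinnedChain_deriv_V, pinnedChain_deriv_V]
    ring
  have h' : deriv (pinnedChain ω₂ lam β γ).V r = deriv (pinnedChain ω₂ lam β γ).V (-r') := by
    rw [hodd]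
    linarith
  have hr := pinnedChain_deriv_V_injective ω₂ lam hβ γ h'
  linarith

/-- **Stub `stub_currentVariancePos` of line `temperature-blind-vitali-hurwitz` (registered
signature).** For `P = pinnedChain ω₂ lam β γ` (all parameters `> 0`), a dynamics `D` with carrier
`bmGood P`, `T > 0` and a shift-invariant DLR Gibbs state `μ` at `T` with the superstability
estimate, preserved by `D`: the static current variance `C_T(0) = D.currentCorrelation μ 0` is
strictly positive. Instance `s₂ = 2` of `currentCorrelation_zero_pos`
(`V'(r) = r + βr³`, `pinnedChain_deriv_V_add_eq_zero`). [folklore] -/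
theorem stub_currentVariancePos :
    ∀ ω₂ lam β γ : ℝ, 0 < ω₂ → 0 < lam → 0 < β → 0 < γ →
      ∀ D : Literature.MathematicalPhysics.KineticTheory.HeatConduction.InfiniteChainDynamics
          (Literature.MathematicalPhysics.KineticTheory.HeatConduction.pinnedChain ω₂ lam β γ),
        D.carrier =
            (Literature.MathematicalPhysics.KineticTheory.HeatConduction.pinnedChain
                ω₂ lam β γ).bmGood →
        ∀ T : ℝ, 0 < T →
          ∀ μ : MeasureTheory.Measure
              Literature.MathematicalPhysics.KineticTheory.HeatConduction.ChainConfig,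
            (Literature.MathematicalPhysics.KineticTheory.HeatConduction.pinnedChain
                ω₂ lam β γ).IsChainGibbsMeasure T μ →
            Literature.MathematicalPhysics.KineticTheory.HeatConduction.IsShiftInvariant μ →
            (Literature.MathematicalPhysics.KineticTheory.HeatConduction.pinnedChain
                ω₂ lam β γ).HasSuperstabilityEstimate μ →
            D.PreservesMeasure μ → 0 < D.currentCorrelation μ 0 := by
  intro ω₂ lam β γ hω hl hβ _ D _ T hT μ hμ hshift hss hD
  have hU : Continuous (pinnedChain ω₂ lam β γ).U := by
    show Continuous fun q : ℝ => ω₂ * q ^ 2 / 2 + lam * q ^ 4 / 4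
    fun_prop
  exact currentCorrelation_zero_pos one_le_two
    (OscillatorChain.pinnedChain_U_nonneg β γ hω.le hl.le) hU
    (OscillatorChain.pinnedChain_isEvenPolyOfDegree_V ω₂ lam γ hβ)
    (pinnedChain_deriv_V_add_eq_zero γ hβ.le) D hT hμ hshift hss hD

end Summit.AtomisticToContinuum.FouriersLaw.Theorems.GreenKuboContinuation.TemperatureBlindVitaliHurwitz

end
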